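import Summits.BirchSwinnertonDyer.Rank1Residual.GaloisImage.PrimeChoiceLocal
import Literature.NumberTheory.GaloisRepresentations.BlochKatoSelmerGroup
import Literature.NumberTheory.GaloisRepresentations.GaloisCohomologyInfResProofs
import Literature.NumberTheory.GaloisRepresentations.IntegralGaloisActionProofs
import Literature.NumberTheory.GaloisRepresentations.RestrictedRamification
import HarnessLib

/-!
# A Selmer class unramified at `v` is represented by a crossed homomorphism vanishing on every
# inertia group above `v` (cell `b2b-bsdres`, team n1011, ROUTE-1 item R1-56 "S24(1) @ m = 1 in the
# kernel", row T-R1-56-S, FILE F-fin part 1: the local–global inertia bridge)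

HONEST FRAMING (verbatim for the cell): research route; prove what is provable now; no claim beyond
stated classes; nothing booked; no mark / label moved.  TOOL theorems of Galois cohomology;
theorems only: no definition, no named fact, no conjecture node.

## What

For a discrete Galois module `M` over a number field `K`, a finite place `v` at which `M` is
unramified, and a continuous crossed homomorphism `f : Γ_K → M` whose class localises into the
unramified subgroup `H¹_ur(K_v, M) = ker (H¹(K_v, M) → H¹(K_v^{nr}, M))`:
* `maxUnramified_normal` — `K_v^{nr} = K_v(μ_{p'})` is normal over `K_v` (stable under `Aut(K̄_v/K_v)`);
* `apply_eq_zero_of_mem_absInertia` (local) — over a non-archimedean local field `F`, a crossed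
  homomorphism whose class lies in `H¹_ur(F, M)`, `M` unramified, VANISHES on the inertia group `I_F`
  (`I_F = Gal(F̄/F^{nr})`, `mem_absInertia_iff_forall_mem_maxUnramified`; a principal crossed
  homomorphism of a trivial module is zero);
* `apply_conj_eq_of_apply_eq_one` — `f(g h g⁻¹) = g · f(h)` when `h` acts trivially;
* **`apply_eq_zero_of_mem_inertia_of_localization_mem`** (global) — `f` vanishes on `I_𝔓` for EVERY
  prime `𝔓 ∣ v` of `\bar ℤ_K` (at the prime `𝔓₀` of the completion by
  `inertia_adicCompletionPrime_eq_map_absInertia`; at `𝔓 = γ • 𝔓₀` by conjugation, the primes above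
  `v` being conjugate, `exists_smul_eq_of_mem_primesAbove_holds`).
Consumer: `SelmerGroupFinite.lean` (finiteness of the Selmer group of a finite module with
unramified local conditions outside a finite set — the `hfin` / `hfind` binders of the Kolyvagin-system
files, for the slice `Sakamoto2024.kolyvaginSystems_freeRankOne_zmod_three_pow_at 1`).

References: J.-P. Serre, *Local Fields*, Ch. IV §4 (the maximal unramified extension); J. S. Milne,
*Arithmetic Duality Theorems* (2006), Ch. I §4 (unramified classes); J. Neukirch, A. Schmidt,
K. Wingberg, *Cohomology of Number Fields* (2008), (7.2.x)/(8.3.x).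
-/

noncomputable section

open scoped NumberField Pointwise
open Function Field NumberField IsDedekindDomain
open Literature.NumberTheory.GaloisRepresentations Literature.NumberTheory.GaloisRepresentations.DiscreteGaloisModule
  Literature.NumberTheory.GaloisRepresentations.IsNonarchimedeanLocalField

universe u

namespace Summit.BirchSwinnertonDyer.Rank1Residual.GaloisImage.SelmerFinite

/-! ## §1. The local statement over a non-archimedean local field -/

section Local

variable {F : Type u} [Field F] [ValuativeRel F] [TopologicalSpace F] [IsNonarchimedeanLocalField F]

omit [TopologicalSpace F] [IsNonarchimedeanLocalField F] in
/-- `F^{nr} = F(μ_{p'}) ⊆ F̄` is a normal extension of `F`: every `F`-automorphism of `F̄` permutes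
the prime-to-`p` roots of unity (Serre, *Local Fields*, Ch. IV §4). [folklore] -/
theorem maxUnramified_normal : Normal F (maxUnramified F) := by
  rw [IntermediateField.normal_iff_forall_map_le']
  intro σ
  rw [maxUnramified, IntermediateField.adjoin_map]
  refine IntermediateField.adjoin.mono F _ _ ?_
  rintro _ ⟨ζ, hζ, rfl⟩
  obtain ⟨N, hN, hζN⟩ := mem_primeToPRootsOfUnity_iff.mp hζ
  exact mem_primeToPRootsOfUnity_iff.mpr ⟨N, hN, by rw [AlgEquiv.coe_toAlgHom, ← map_pow, hζN, map_one]⟩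

variable {M : Type u} [AddCommGroup M] [TopologicalSpace M] [DiscreteTopology M]

/-- **An unramified class of an unramified module is represented by a crossed homomorphism
vanishing on the inertia group.**  If `I_F` acts trivially on `M` and the class of `f` lies in
`H¹_ur(F, M) = ker (H¹(F, M) → H¹(F^{nr}, M))`, then `f(t) = 0` for every `t ∈ I_F`: the pull-back
of `f` to `Γ_{F^{nr}}` is principal, `f(t) = t·w − w`, and `t` acts trivially; and `Γ_{F^{nr}} → Γ_F`
is onto `I_F = Gal(F̄/F^{nr})`. [folklore] -/
theorem apply_eq_zero_of_mem_absInertia (τ : DiscreteGaloisModule F M)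
    (hI : ∀ t ∈ absInertia F, τ t = 1) (f : contOneCocycles τ.toTopRep)
    (hf : oneCocycleClass τ.toTopRep f ∈ unramifiedSubgroup τ 1) :
    ∀ t ∈ absInertia F, f.1 t = 0 := by
  haveI : Normal F (maxUnramified F) := maxUnramified_normal
  set E := maxUnramified F with hE
  replace hf := (mem_unramifiedSubgroup_iff τ 1 _).mp hf
  have hres : galoisCohomology.res τ E 1 (oneCocycleClass τ.toTopRep f) =
      oneCocycleClass (DiscreteGaloisModule.toTopRep (GaloisRep.restrictField E τ))
        (contOneCocycles.pullback (absGaloisRestrict F E) (X := τ.toTopRep)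
          (Y := DiscreteGaloisModule.toTopRep (GaloisRep.restrictField E τ))
          (TopRep.ofHom ⟨ContinuousLinearMap.id ℤ M, fun _ => rfl⟩) f) :=
    map_oneCocycleClass _ _ _ f
  rw [hres] at hf
  obtain ⟨w, hw⟩ := (oneCocycleClass_eq_zero_iff _ _).mp hf
  -- the image of `Γ_{F^{nr}}` is `I_F`, which acts trivially
  have hfix : ∀ t' : absoluteGaloisGroup E, absGaloisRestrict F E t' ∈ absInertia F := fun t' =>
    mem_absInertia_iff_forall_mem_maxUnramified.mpr
      ((mem_absGaloisFixingSubgroup_iff E _).mp (absGaloisRestrict_mem_absGaloisFixingSubgroup F E t'))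
  have hval : ∀ t' : absoluteGaloisGroup E, f.1 (absGaloisRestrict F E t') = 0 := fun t' => by
    have h := hw t'
    rw [contOneCocycles.pullback_apply] at h
    change f.1 (absGaloisRestrict F E t') = τ (absGaloisRestrict F E t') w - w at h
    rw [hI _ (hfix t'), Module.End.one_apply, sub_self] at h
    exact h
  intro t ht
  obtain ⟨t', rfl⟩ := exists_absGaloisRestrict_eq F E t
    ((mem_absGaloisFixingSubgroup_iff E t).mpr (mem_absInertia_iff_forall_mem_maxUnramified.mp ht))
  exact hval t'

end Local

/-! ## §2. Conjugation, and the global statement over a number field -/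

section Global

variable {K : Type u} [Field K] [NumberField K]
variable {M : Type u} [AddCommGroup M] [TopologicalSpace M] [DiscreteTopology M]
variable (ρ : DiscreteGaloisModule K M)

omit [NumberField K] in
/-- `f(g h g⁻¹) = g · f(h)` for a crossed homomorphism `f` and `h` acting trivially on `M`
(`f(g) + g·f(g⁻¹) = f(1) = 0`). [folklore] -/
theorem apply_conj_eq_of_apply_eq_one (f : contOneCocycles ρ.toTopRep) {g h : absoluteGaloisGroup K}
    (hh : ρ h = 1) : f.1 (g * h * g⁻¹) = ρ g (f.1 h) := by
  have h1 := f.2 (g * h) g⁻¹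
  have h2 := f.2 g h
  have h3 := f.2 g g⁻¹
  rw [mul_inv_cancel, contOneCocycles.apply_one] at h3
  change f.1 (g * h * g⁻¹) = f.1 (g * h) + ρ (g * h) (f.1 g⁻¹) at h1
  change f.1 (g * h) = f.1 g + ρ g (f.1 h) at h2
  change (0 : M) = f.1 g + ρ g (f.1 g⁻¹) at h3
  rw [h1, h2, map_mul, hh, mul_one, add_assoc, add_comm (ρ g (f.1 h)), ← add_assoc, ← h3, zero_add]

/-- **A crossed homomorphism whose class is unramified at `v` vanishes on every inertia group
above `v`**, for `M` unramified at `v`: at the prime `𝔓₀` of the completion (`I_{𝔓₀}` is the image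
of `I_{K_v}`, `inertia_adicCompletionPrime_eq_map_absInertia`, and the local statement
`apply_eq_zero_of_mem_absInertia`), then at every `𝔓 = γ • 𝔓₀` by conjugation
(`apply_conj_eq_of_apply_eq_one`; the primes above `v` are conjugate). [folklore] -/
theorem apply_eq_zero_of_mem_inertia_of_localization_mem {v : HeightOneSpectrum (𝓞 K)}
    (hunr : GaloisRep.IsUnramifiedAt v ρ) (f : contOneCocycles ρ.toTopRep)
    (hf : galoisCohomology.localization ρ (Sum.inr v) 1 (oneCocycleClass ρ.toTopRep f) ∈
      unramifiedSubgroup (GaloisRep.toLocal v ρ) 1) :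
    ∀ 𝔓 ∈ v.primesAbove, ∀ σ ∈ 𝔓.inertia (absoluteGaloisGroup K), f.1 σ = 0 := by
  set L := v.adicCompletion K with hL
  set res := absGaloisRestrict K L with hres_def
  have h𝔓₀ := adicCompletionPrime_mem_primesAbove K v
  -- Step 1: `f` vanishes on `I_{𝔓₀} = res (I_{K_v})`
  have hIρ : ∀ t ∈ absInertia L, GaloisRep.toLocal v ρ t = 1 :=
    (GaloisRep.isUnramifiedAt_iff_toLocal_holds v ρ).1 hunr
  rw [PrimeChoice.localization_inr_oneCocycleClass] at hf
  have hloc := apply_eq_zero_of_mem_absInertia (GaloisRep.toLocal v ρ) hIρ _ hf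
  have h0 : ∀ σ ∈ (adicCompletionPrime K v).inertia (absoluteGaloisGroup K), f.1 σ = 0 := by
    intro σ hσ
    rw [inertia_adicCompletionPrime_eq_map_absInertia] at hσ
    obtain ⟨t, ht, rfl⟩ := Subgroup.mem_map.mp hσ
    have := hloc t ht
    rwa [contOneCocycles.pullback_apply] at this
  -- Step 2: every `𝔓 ∣ v` is conjugate to `𝔓₀`: `δ • 𝔓 = 𝔓₀`
  intro 𝔓 h𝔓 σ hσ
  obtain ⟨δ, hδ⟩ := HeightOneSpectrum.exists_smul_eq_of_mem_primesAbove_holds h𝔓 h𝔓₀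
  have hσ' : δ * σ * δ⁻¹ ∈ (adicCompletionPrime K v).inertia (absoluteGaloisGroup K) := by
    have h := conj_mem_inertia_smul hσ δ
    rwa [hδ] at h
  have hρσ' : ρ (δ * σ * δ⁻¹) = 1 := hunr _ h𝔓₀ _ hσ'
  have hfσ' : f.1 (δ * σ * δ⁻¹) = 0 := h0 _ hσ'
  have hσeq : σ = δ⁻¹ * (δ * σ * δ⁻¹) * δ⁻¹⁻¹ := by group
  rw [hσeq, apply_conj_eq_of_apply_eq_one ρ f hρσ', hfσ', map_zero]

/-- The same for a Selmer class of a Selmer structure that is UNRAMIFIED at `v`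
(`𝓕_v = H¹_ur(K_v, M)`). [folklore] -/
theorem apply_eq_zero_of_mem_inertia_of_mem_selmerGroup {𝓕 : SelmerStructure ρ}
    {v : HeightOneSpectrum (𝓞 K)} (hunr : GaloisRep.IsUnramifiedAt v ρ)
    (h𝓕v : 𝓕 (Sum.inr v) = unramifiedSubgroup (GaloisRep.toLocal v ρ) 1)
    (f : contOneCocycles ρ.toTopRep) (hf : oneCocycleClass ρ.toTopRep f ∈ 𝓕.selmerGroup) :
    ∀ 𝔓 ∈ v.primesAbove, ∀ σ ∈ 𝔓.inertia (absoluteGaloisGroup K), f.1 σ = 0 := by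
  refine apply_eq_zero_of_mem_inertia_of_localization_mem ρ hunr f ?_
  have h := (SelmerStructure.mem_selmerGroup_iff _ _).mp hf (Sum.inr v)
  rwa [h𝓕v] at h

end Global

end Summit.BirchSwinnertonDyer.Rank1Residual.GaloisImage.SelmerFinite

end
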